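import Mathlib.Analysis.SpecialFunctions.Exponential
import Mathlib.Topology.Algebra.InfiniteSum.NatInt
import Literature.Probability.LatticeModels.GinibreCharacterExpansion
import Literature.Probability.LatticeModels.PlaneRotatorGinibreComparison
import HarnessLib

/-!
# The double Poisson-current expansion of plane-rotator character integrals

Topic `Literature/Probability/LatticeModels`. For the plane-rotator (classical XY) model with pair couplings
`J : V × V → ℝ` on ordered pairs (weight `e^{∑_{(x,y)} J(x,y) cos(θ_y − θ_x)}`, the tree's `ginibreWeight (pairChars V) J`
of `PlaneRotatorGinibreComparison.lean`) every unnormalised character integral is a sum over NON-NEGATIVE INTEGER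
CURRENTS — `p` arrows `x → y` and `q` arrows `y → x` on every ordered pair — with the Poisson weights
`(J/2)^{p+q}/(p! q!)` and the constraint that the total character is trivial:

  `∫ χ₀(θ) e^{∑ J cos} dθ = ∑_{n : (V×V)×Bool → ℤ, n ≥ 0, χ₀ ∏ χₐ^{nₐ} = 1} ∏ₐ (Jₐ/2)^{nₐ}/nₐ!`

(`e^{J cos(θ_y−θ_x)} = e^{(J/2) θ̄_xθ_y} e^{(J/2) θ_xθ̄_y}`, each factor expanded in its exponential series; then the
character expansion `integral_coe_char_mul_prod_tsum` of `GinibreCharacterExpansion.lean`). This is the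
expansion used by E. H. Lieb, *A refinement of Simon's correlation inequality*, Comm. Math. Phys. 77 (1980)
127–135 [Lieb1980], p. 133 ("If both sides of (27) are expanded in a power series in `β` … this is just the
graphical exercise mentioned above": subgraphs of a directed multigraph), i.e. the setting of Rivasseau's digraph
lemma (`RivasseauDigraphLemma.lean`); it is Step A of the tree's plan to discharge the named fact
`PlaneRotator.LiebRivasseauInequality` (cell `pub/hubbard-tc`, INTERLAYER-v0.1.md §14).

* `PlaneRotator.poissonChars V` — the characters `θ̄_xθ_y` (`(p, true)`) and `θ_xθ̄_y` (`(p, false)`), `p = (x, y)`;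
* `PlaneRotator.poissonCoeff x m = (x/2)^m/m!` (`m ≥ 0`), `0` (`m < 0`); `summable_norm_poissonCoeff`;
  `hasSum_poissonCoeff_mul_pow` (`∑_m c(m) z^m = e^{(x/2) z}`);
* `PlaneRotator.prod_tsum_poisson_eq_ginibreWeight` — the pointwise identity
  `∏ₐ (∑_m cₐ(m) χₐ(θ)^m) = e^{∑ J cos}`;
* `PlaneRotator.integral_coe_char_mul_ginibreWeight_eq_tsum_poisson` — **the expansion**.
-/

noncomputable section

open MeasureTheory Filter Finset
open scoped Topology BigOperators Nat

namespace Literature.Probability.LatticeModels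

namespace PlaneRotator

variable {V : Type*}

/-! ### Poisson characters and coefficients -/

variable (V) in
/-- The **Poisson characters** of the plane-rotator model on ordered pairs: for `a = ((x, y), true)` the forward
relative angle `θ̄_xθ_y` (`diffChar x y`), for `a = ((x, y), false)` its inverse `θ_xθ̄_y`. An integer `nₐ ≥ 0` on
`((x,y), true)` is read as `nₐ` arrows from `x` to `y`. [cite: Lieb1980, p. 133 (power series in β; directed graphs)] -/
def poissonChars (a : (V × V) × Bool) : (V → Circle) →ₜ* Circle :=
  if a.2 then diffChar a.1.1 a.1.2 else (diffChar a.1.1 a.1.2)⁻¹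

/-- `poissonChars` on a forward index. [cite: Lieb1980, p. 133 (power series in β; directed graphs)] -/
@[simp] theorem poissonChars_true (p : V × V) : poissonChars V (p, true) = diffChar p.1 p.2 := if_pos rfl

/-- `poissonChars` on a backward index. [cite: Lieb1980, p. 133 (power series in β; directed graphs)] -/
@[simp] theorem poissonChars_false (p : V × V) : poissonChars V (p, false) = (diffChar p.1 p.2)⁻¹ := by
  simp [poissonChars]

/-- The **Poisson coefficients** `(x/2)^m / m!` for `m ≥ 0` and `0` for `m < 0`: the coefficients of the
exponential series of `e^{(x/2) z}`. [cite: Lieb1980, p. 133 (power series in β)] -/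
def poissonCoeff (x : ℝ) (m : ℤ) : ℂ :=
  if 0 ≤ m then (((x / 2 : ℝ) : ℂ) ^ m.toNat) / (m.toNat ! : ℂ) else 0

/-- On natural numbers the Poisson coefficient is `(x/2)^n/n!`. [cite: Lieb1980, p. 133 (power series in β; directed graphs)] -/
@[simp] theorem poissonCoeff_natCast (x : ℝ) (n : ℕ) :
    poissonCoeff x (n : ℤ) = (((x / 2 : ℝ) : ℂ) ^ n) / (n ! : ℂ) := by
  simp [poissonCoeff]

/-- On negative integers the Poisson coefficient vanishes. [cite: Lieb1980, p. 133 (power series in β; directed graphs)] -/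
@[simp] theorem poissonCoeff_neg_succ (x : ℝ) (n : ℕ) : poissonCoeff x (-((n : ℤ) + 1)) = 0 := by
  rw [poissonCoeff, if_neg (by omega)]

/-- The Poisson coefficients vanish off the non-negative integers. [cite: Lieb1980, p. 133 (power series in β; directed graphs)] -/
theorem poissonCoeff_of_neg (x : ℝ) {m : ℤ} (hm : m < 0) : poissonCoeff x m = 0 := by
  rw [poissonCoeff, if_neg (not_le.2 hm)]

/-- The Poisson coefficients are real and non-negative for `x ≥ 0`: `poissonCoeff x m = ((x/2)^m/m! : ℝ)`.
[cite: Lieb1980, p. 133 (power series in β; directed graphs)] -/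
theorem poissonCoeff_eq_ofReal (x : ℝ) (m : ℤ) :
    poissonCoeff x m = ((if 0 ≤ m then (x / 2) ^ m.toNat / (m.toNat ! : ℝ) else 0 : ℝ) : ℂ) := by
  unfold poissonCoeff
  split_ifs <;> push_cast <;> rfl

/-- The Poisson coefficients are absolutely summable over `ℤ` (`∑ |x/2|^n/n! = e^{|x|/2}` on `ℕ`, zero on the
negatives). [cite: Lieb1980, p. 133 (power series in β; directed graphs)] -/
theorem summable_norm_poissonCoeff (x : ℝ) : Summable fun m : ℤ => ‖poissonCoeff x m‖ := by
  refine Summable.of_nat_of_neg_add_one ?_ ?_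
  · have h := (NormedSpace.expSeries_div_summable (((x / 2 : ℝ) : ℂ))).norm
    refine h.congr fun n => ?_
    simp only [poissonCoeff_natCast]
  · simp only [poissonCoeff_neg_succ, norm_zero]
    exact summable_zero

/-- The `ℕ`-part of the Poisson series is the exponential series of `(x/2) z`. [folklore] -/
private theorem hasSum_poissonCoeff_nat (x : ℝ) (z : ℂ) :
    HasSum (fun n : ℕ => poissonCoeff x (n : ℤ) * z ^ ((n : ℕ) : ℤ)) (Complex.exp (((x / 2 : ℝ) : ℂ) * z)) := by
  have h := NormedSpace.expSeries_div_hasSum_exp (((x / 2 : ℝ) : ℂ) * z)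
  rw [← Complex.exp_eq_exp_ℂ] at h
  have hfun : (fun n : ℕ => poissonCoeff x (n : ℤ) * z ^ ((n : ℕ) : ℤ)) =
      fun n : ℕ => (((x / 2 : ℝ) : ℂ) * z) ^ n / (n ! : ℂ) := by
    funext n
    rw [poissonCoeff_natCast, zpow_natCast, mul_pow, div_mul_eq_mul_div]
  rw [hfun]
  exact h

/-- **The exponential series through the Poisson coefficients**: `∑_m poissonCoeff x m · z^m = e^{(x/2) z}`.
[cite: Lieb1980, p. 133 (power series in β; directed graphs)] -/
theorem hasSum_poissonCoeff_mul_zpow (x : ℝ) (z : ℂ) :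
    HasSum (fun m : ℤ => poissonCoeff x m * z ^ m) (Complex.exp (((x / 2 : ℝ) : ℂ) * z)) := by
  have hneg : HasSum (fun n : ℕ => (fun m : ℤ => poissonCoeff x m * z ^ m) (-((n : ℤ) + 1))) 0 := by
    simp only [poissonCoeff_neg_succ, zero_mul]
    exact hasSum_zero
  have := HasSum.of_nat_of_neg_add_one (f := fun m : ℤ => poissonCoeff x m * z ^ m) (hasSum_poissonCoeff_nat x z) hneg
  rwa [add_zero] at this

/-! ### The pointwise identity: the product of the Poisson series is the Gibbs weight -/

/-- For a point `z` of the unit circle, `e^{(x/2) z} e^{(x/2) z̄} = e^{x Re z}`. [folklore] -/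
private theorem exp_mul_exp_conj (x : ℝ) (z : Circle) :
    Complex.exp (((x / 2 : ℝ) : ℂ) * (z : ℂ)) * Complex.exp (((x / 2 : ℝ) : ℂ) * ((z⁻¹ : Circle) : ℂ)) =
      ((Real.exp (x * (z : ℂ).re) : ℝ) : ℂ) := by
  have he : ((x / 2 : ℝ) : ℂ) * (z : ℂ) + ((x / 2 : ℝ) : ℂ) * ((z⁻¹ : Circle) : ℂ) = ((x * (z : ℂ).re : ℝ) : ℂ) := by
    rw [Circle.coe_inv_eq_conj, ← mul_add, Complex.add_conj]
    push_cast
    ring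
  rw [← Complex.exp_add, he, Complex.ofReal_exp]

variable [Fintype V]

/-- **Pointwise identity.** `∏_{a ∈ (V×V)×Bool} (∑_m poissonCoeff (J a.1) m · (poissonChars V a θ)^m) = e^{∑_p J(p) cos(θ_{p.2} − θ_{p.1})}`
— the Gibbs weight `ginibreWeight (pairChars V) J θ` as the product of the forward and backward exponential series
of every ordered pair. [cite: Lieb1980, p. 133 (power series in β)] -/
theorem prod_tsum_poisson_eq_ginibreWeight (J : V × V → ℝ) (θ : V → Circle) :
    ∏ a : (V × V) × Bool, ∑' m : ℤ, poissonCoeff (J a.1) m * ((poissonChars V a θ : Circle) : ℂ) ^ m =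
      (ginibreWeight (pairChars V) J θ : ℂ) := by
  rw [Fintype.prod_prod_type, ginibreWeight, ginibreHamiltonian, Real.exp_sum, Complex.ofReal_prod]
  refine Finset.prod_congr rfl fun p _ => ?_
  rw [Fintype.prod_bool, poissonChars_true, poissonChars_false,
    (hasSum_poissonCoeff_mul_zpow (J p) _).tsum_eq, (hasSum_poissonCoeff_mul_zpow (J p) _).tsum_eq]
  rw [show ((diffChar p.1 p.2)⁻¹ θ : Circle) = (diffChar p.1 p.2 θ)⁻¹ from rfl, exp_mul_exp_conj]
  congr 1

/-! ### The expansion -/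

variable [MeasurableSpace Circle] [BorelSpace Circle]

open Classical in
/-- **The double Poisson-current expansion of plane-rotator character integrals.** For pair couplings
`J : V × V → ℝ` and any continuous unitary character `χ₀` of the torus `U(1)^V`,
`∫ χ₀(θ) e^{∑_p J(p) cos(θ_{p.2} − θ_{p.1})} dθ = ∑_{n : (V×V)×Bool → ℤ} [χ₀ ∏ₐ (poissonChars a)^{nₐ} = 1] ∏ₐ poissonCoeff (J a.1) (nₐ)`,
the sum being supported on `n ≥ 0` (`poissonCoeff` vanishes on negatives): `nₐ` arrows along `x → y` for
`a = ((x,y), true)`, along `y → x` for `a = ((x,y), false)`, Poisson weights `(J/2)^{n}/n!`, and the constraint that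
the total character is trivial (orthogonality of characters). [cite: Lieb1980, p. 133 (power series in β; directed graphs)] -/
theorem integral_coe_char_mul_ginibreWeight_eq_tsum_poisson (J : V × V → ℝ) (χ₀ : (V → Circle) →ₜ* Circle) :
    ∫ θ, ((χ₀ θ : Circle) : ℂ) * (ginibreWeight (pairChars V) J θ : ℂ) ∂torusHaar V =
      ∑' n : (V × V) × Bool → ℤ,
        if twistChar (poissonChars V) χ₀ n = 1 then ∏ a, poissonCoeff (J a.1) (n a) else 0 := by
  have h := integral_coe_char_mul_prod_tsum (torusHaar V) (poissonChars V) χ₀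
    (c := fun a => poissonCoeff (J a.1)) (fun a => summable_norm_poissonCoeff (J a.1))
  rw [← h]
  refine integral_congr_ae (ae_of_all _ fun θ => ?_)
  simp only [prod_tsum_poisson_eq_ginibreWeight J θ]

/-! ### Monomial characters of the torus and the valence criterion for the constraint -/

omit [Fintype V] [MeasurableSpace Circle] [BorelSpace Circle] in
/-- The head of the arrow indexed by `a`: `y` for `((x,y), true)`, `x` for `((x,y), false)`. [folklore] -/
def arrowHead (a : (V × V) × Bool) : V := if a.2 then a.1.2 else a.1.1

omit [Fintype V] [MeasurableSpace Circle] [BorelSpace Circle] in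
/-- The tail of the arrow indexed by `a`: `x` for `((x,y), true)`, `y` for `((x,y), false)`. [folklore] -/
def arrowTail (a : (V × V) × Bool) : V := if a.2 then a.1.1 else a.1.2

/-- The **monomial character** `θ ↦ ∏_v θ_v^{k_v}` of the torus `U(1)^V` with integer exponents `k` (Ginibre's
`e^{i m·φ}`, real part `cos(m·φ)`). [cite: Ginibre1970, Example 4 (plane rotators: characters e^{i m·φ} of the torus)] -/
def monomialChar (k : V → ℤ) : (V → Circle) →ₜ* Circle where
  toFun θ := ∏ v, (θ v) ^ (k v)
  map_one' := by simp
  map_mul' θ θ' := by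
    simp only [Pi.mul_apply, mul_zpow, Finset.prod_mul_distrib]
  continuous_toFun := continuous_finsetProd _ fun v _ => (continuous_apply v).zpow (k v)

omit [MeasurableSpace Circle] [BorelSpace Circle] in
/-- `monomialChar k θ = ∏_v θ_v^{k_v}`. [cite: Ginibre1970, Example 4 (plane rotators: characters e^{i m·φ} of the torus)] -/
@[simp] theorem monomialChar_apply (k : V → ℤ) (θ : V → Circle) : monomialChar k θ = ∏ v, (θ v) ^ (k v) := rfl

omit [MeasurableSpace Circle] [BorelSpace Circle] in
/-- `monomialChar 0 = 1`. [cite: Ginibre1970, Example 4 (plane rotators: characters e^{i m·φ} of the torus)] -/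
theorem monomialChar_zero : monomialChar (0 : V → ℤ) = 1 := by
  ext θ; simp

omit [MeasurableSpace Circle] [BorelSpace Circle] in
/-- `monomialChar (k + k') = monomialChar k · monomialChar k'`. [cite: Ginibre1970, Example 4 (plane rotators: characters e^{i m·φ} of the torus)] -/
theorem monomialChar_add (k k' : V → ℤ) : monomialChar (k + k') = monomialChar k * monomialChar k' := by
  ext θ
  simp only [monomialChar_apply, ContinuousMonoidHom.mul_apply, Pi.add_apply, zpow_add, Finset.prod_mul_distrib,
    Circle.coe_mul]

omit [MeasurableSpace Circle] [BorelSpace Circle] in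
/-- `monomialChar (−k) = (monomialChar k)⁻¹`. [cite: Ginibre1970, Example 4 (plane rotators: characters e^{i m·φ} of the torus)] -/
theorem monomialChar_neg (k : V → ℤ) : monomialChar (-k) = (monomialChar k)⁻¹ := by
  rw [eq_inv_iff_mul_eq_one, ← monomialChar_add, neg_add_cancel, monomialChar_zero]

omit [MeasurableSpace Circle] [BorelSpace Circle] in
/-- `monomialChar (∑ₐ eₐ) θ = ∏ₐ monomialChar eₐ θ`. [cite: Ginibre1970, Example 4 (plane rotators: characters e^{i m·φ} of the torus)] -/
theorem monomialChar_sum_apply {ι : Type*} (s : Finset ι) (e : ι → V → ℤ) (θ : V → Circle) :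
    monomialChar (∑ a ∈ s, e a) θ = ∏ a ∈ s, monomialChar (e a) θ := by
  classical
  induction s using Finset.induction_on with
  | empty => simp
  | insert a s ha ih => rw [Finset.sum_insert ha, Finset.prod_insert ha, monomialChar_add,
      ContinuousMonoidHom.mul_apply, ih]

omit [MeasurableSpace Circle] [BorelSpace Circle] in
/-- `monomialChar (n • d) θ = (monomialChar d θ)^n`. [cite: Ginibre1970, Example 4 (plane rotators: characters e^{i m·φ} of the torus)] -/
theorem monomialChar_zsmul_apply (n : ℤ) (d : V → ℤ) (θ : V → Circle) :
    monomialChar (n • d) θ = (monomialChar d θ) ^ n := by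
  simp only [monomialChar_apply, Pi.smul_apply, smul_eq_mul, ← Finset.prod_zpow]
  refine Finset.prod_congr rfl fun v _ => ?_
  rw [mul_comm, zpow_mul]

omit [MeasurableSpace Circle] [BorelSpace Circle] in
/-- `monomialChar (Pi.single v m) θ = θ_v^m`. [cite: Ginibre1970, Example 4 (plane rotators: characters e^{i m·φ} of the torus)] -/
theorem monomialChar_single_apply [DecidableEq V] (v : V) (m : ℤ) (θ : V → Circle) :
    monomialChar (Pi.single v m) θ = (θ v) ^ m := by
  rw [monomialChar_apply, Finset.prod_eq_single v (fun w _ hw => by rw [Pi.single_eq_of_ne hw, zpow_zero])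
    (fun h => absurd (Finset.mem_univ v) h), Pi.single_eq_same]

omit [MeasurableSpace Circle] [BorelSpace Circle] in
/-- The relative-angle character is monomial: `θ̄_xθ_y = ∏_v θ_v^{δ_{v,y} − δ_{v,x}}`. [cite: Ginibre1970, Example 4 (plane rotators: characters e^{i m·φ} of the torus)] -/
theorem diffChar_eq_monomialChar [DecidableEq V] (x y : V) :
    diffChar x y = monomialChar (Pi.single y 1 - Pi.single x 1) := by
  refine ContinuousMonoidHom.ext fun θ => ?_
  rw [sub_eq_add_neg, monomialChar_add, ContinuousMonoidHom.mul_apply, monomialChar_neg,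
    show ((monomialChar (Pi.single x (1 : ℤ)))⁻¹) θ = (monomialChar (Pi.single x (1 : ℤ)) θ)⁻¹ from rfl,
    monomialChar_single_apply, monomialChar_single_apply, zpow_one, zpow_one, diffChar_apply, mul_comm]

omit [MeasurableSpace Circle] [BorelSpace Circle] in
/-- The Poisson characters are monomial: `poissonChars V a = ∏_v θ_v^{δ_{v, head a} − δ_{v, tail a}}`. [cite: Ginibre1970, Example 4 (plane rotators: characters e^{i m·φ} of the torus)] -/
theorem poissonChars_eq_monomialChar [DecidableEq V] (a : (V × V) × Bool) :
    poissonChars V a = monomialChar ((Pi.single (arrowHead a) (1 : ℤ) : V → ℤ) - Pi.single (arrowTail a) 1) := by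
  obtain ⟨p, b⟩ := a
  cases b
  · rw [poissonChars_false, arrowHead, arrowTail, diffChar_eq_monomialChar, ← monomialChar_neg, neg_sub]
    simp
  · rw [poissonChars_true, arrowHead, arrowTail, diffChar_eq_monomialChar]
    simp

omit [MeasurableSpace Circle] [BorelSpace Circle] in
/-- Twisting a monomial character by monomial characters adds the exponents:
`(monomialChar k) · ∏ₐ (monomialChar dₐ)^{nₐ} = monomialChar (k + ∑ₐ nₐ • dₐ)`. [cite: Ginibre1970, Example 4 (plane rotators: characters e^{i m·φ} of the torus)] -/
theorem twistChar_monomialChar {ι : Type*} [Fintype ι] (d : ι → V → ℤ) (k : V → ℤ) (n : ι → ℤ) :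
    twistChar (fun a => monomialChar (d a)) (monomialChar k) n = monomialChar (k + ∑ a, n a • d a) := by
  ext θ
  rw [twistChar_apply, monomialChar_add, ContinuousMonoidHom.mul_apply, monomialChar_sum_apply]
  congr 2
  refine Finset.prod_congr rfl fun a _ => ?_
  rw [monomialChar_zsmul_apply]

omit [MeasurableSpace Circle] [BorelSpace Circle] in
/-- **A monomial character is trivial iff all its exponents vanish** (test it on the configuration
`e^{iπ/k_v}` at `v`, `1` elsewhere). [cite: Ginibre1970, Example 4 (plane rotators: characters e^{i m·φ} of the torus)] -/
theorem monomialChar_eq_one_iff [DecidableEq V] (k : V → ℤ) : monomialChar k = 1 ↔ k = 0 := by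
  constructor
  · intro h
    funext v
    by_contra hv
    set t : ℝ := Real.pi / (k v : ℝ) with ht
    have hθ : ((monomialChar k (Pi.mulSingle v (Circle.exp t)) : Circle) : ℂ) = 1 := by
      rw [h]
      show ((1 : Circle) : ℂ) = 1
      exact Circle.coe_one
    rw [monomialChar_apply, Finset.prod_eq_single v (fun w _ hw => by rw [Pi.mulSingle_eq_of_ne hw, one_zpow])
      (fun h' => absurd (Finset.mem_univ v) h'), Pi.mulSingle_eq_same, Circle.coe_zpow, Circle.coe_exp,
      ← Complex.exp_int_mul] at hθ
    have harg : (k v : ℂ) * ((t : ℝ) * Complex.I) = Real.pi * Complex.I := by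
      rw [ht, ← mul_assoc]
      congr 1
      have hk : (k v : ℂ) ≠ 0 := by exact_mod_cast hv
      push_cast
      field_simp
    rw [harg, Complex.exp_pi_mul_I] at hθ
    norm_num at hθ
  · rintro rfl
    exact monomialChar_zero

/-- The **exponent vector** of a current `n` at the vertex `v`: arrows in minus arrows out,
`∑ₐ nₐ (δ_{v, head a} − δ_{v, tail a})`. [cite: Lieb1980, p. 133 (valence = arrows in minus arrows out)] -/
def exponent [DecidableEq V] (n : (V × V) × Bool → ℤ) (v : V) : ℤ :=
  ∑ a, n a * ((if v = arrowHead a then 1 else 0) - (if v = arrowTail a then 1 else 0))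

omit [MeasurableSpace Circle] [BorelSpace Circle] in
/-- **Valence criterion for the constraint.** For a monomial observable `χ₀ = ∏_v θ_v^{k_v}` (e.g.
`θ̄_cθ_a = diffChar c a`, `k = δ_a − δ_c`) the term `n` of the Poisson-current expansion survives iff at every
vertex the arrows of `n` balance the exponent of the observable: `k_v + ∑ₐ nₐ(δ_{v,head a} − δ_{v,tail a}) = 0`.
[cite: Lieb1980, p. 133 (subgraphs with prescribed valences)] -/
theorem twistChar_poissonChars_eq_one_iff [DecidableEq V] (k : V → ℤ) (n : (V × V) × Bool → ℤ) :
    twistChar (poissonChars V) (monomialChar k) n = 1 ↔ ∀ v, k v + exponent n v = 0 := by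
  have hχ : poissonChars V = fun a => monomialChar ((Pi.single (arrowHead a) (1 : ℤ) : V → ℤ) - Pi.single (arrowTail a) 1) :=
    funext fun a => poissonChars_eq_monomialChar a
  rw [hχ, twistChar_monomialChar, monomialChar_eq_one_iff]
  constructor
  · intro h v
    have := congrFun h v
    simpa [exponent, Finset.sum_apply, Pi.smul_apply, smul_eq_mul, Pi.sub_apply, Pi.single_apply] using this
  · intro h
    funext v
    have := h v
    simpa [exponent, Finset.sum_apply, Pi.smul_apply, smul_eq_mul, Pi.sub_apply, Pi.single_apply] using this

end PlaneRotator

end Literature.Probability.LatticeModels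

end
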